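import Literature.Barriers.ValiantsHypothesis.BILPS19MembershipHardness
import HarnessLib

/-!
# Low-weight words of a twisted Reed–Solomon code (algebra core of a reduction to BILPS Thm 36)

Sibling proof file of `BILPS19MembershipHardness.lean` (val-lit X5, §8), theorem-only. BILPS Thm 36
("`HMinRank_{K,F}` is NP-hard for `n × (2n+1) × (2n+1)` tensors and `r = n + 1`", characteristic `0`,
arXiv:1911.02534 p0034:L1–L36) is proved in print by a reduction from a Partition variant through
the bordered Vandermonde matrix `A` of p0034:L12–L20, a kernel basis `b_1, …, b_n` of `A`, and the
diagonal slices `B_i = diag(b_i)`: "the rank of a linear combination of `B_i` is equal to the number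
of nonzero coordinates in the corresponding linear combination of vectors `b_i`" (p0034:L33), and
`ker A` has a word with `≤ n + 1` nonzero coordinates iff the Partition instance is solvable
(p0034:L26–L31, the Vandermonde minors of [Vardy97]).

This file proves the ALGEBRA CORE of that argument in its DUAL (generator) form, which needs neither
the kernel basis nor elimination and repairs a gap of the printed text (the integers must be
pairwise DISTINCT: with `a_i = a_j` the word `e_i − e_j ∈ ker A` has weight `2`, p0034:L26 fails).
Read `ker A` as a code by a generator: for pairwise distinct evaluation points `x_1, …, x_{2m+2}` of
a field `F` and a target `c ∈ F`, the word of a coefficient vector `y ∈ F^{m+1}` (polynomial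
`p_y = Σ_a y_a X^a` of degree `≤ m`) is `(p_y(x_1), …, p_y(x_{2m+2}), τ(y))` with the TWIST
`τ(y) = Σ_a y_a g_a`, `g_m = −c`, `g_{m−1} = −1`, `g_a = 0` otherwise. Then (every field):

* `BILPS19Thm36.exists_subset_of_weight_le` (⇒): if `y ≠ 0` and the word has at most `m + 2`
  nonzero coordinates, there is an `m`-set `R` of points with `Σ_{x ∈ R} x = c` — a nonzero
  polynomial of degree `≤ m` has at most `m` roots among `2m+2` distinct points
  (`Polynomial.card_le_degree_of_subset_roots`), so the evaluation part alone has weight `≥ m + 2`,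
  equality forces `p_y = λ Π_{x ∈ R} (X − x)` on an `m`-set `R` of points and `τ(y) = 0`, and Vieta
  (`Polynomial.prod_X_sub_C_coeff_card_pred`) turns `τ(y) = −c y_m − y_{m−1} = λ (Σ_R x − c)` into
  `Σ_R x = c`;
* `BILPS19Thm36.weight_of_subset` (⇐): for an `m`-set `R` of points with `Σ_R x = c` the coefficient
  vector of `Π_{x∈R} (X − x)` is a nonzero `y` whose word has exactly `m + 2` nonzero coordinates
  (`τ(y) = 0`);
* `BILPS19Thm36.rank_diagonal_eq_card_filter` (p0034:L33): the rank of a diagonal matrix is the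
  number of its nonzero entries (Mathlib `Matrix.rank_diagonal`), in the counting form used by the
  reduction.

With `m + 1` diagonal slices `diag(x_1^a, …, x_{2m+2}^a, g_a)` of size `2m + 3 = 2(m+1) + 1` and the
bound `r = m + 2 = (m+1) + 1` this is exactly the shape of Thm 36; the instance map from SUBSET SUM
(the tree's `KNAPSACK`), its machine and the discharge of `BILPS2019_thm36` are NOT in this file
(val-lit lead-np RULING (75): algebra core only). Theorem-only file, no statement of
`BILPS19MembershipHardness.lean` is touched, no new fact. HONEST FRAMING (val-lit): typed
literature; `VP ≠ VNP` is NOT proved and nothing here is progress on it.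

## References

* [BlaserIkenmeyerLysikovPandeySchreyer2019] M. Bläser, C. Ikenmeyer, V. Lysikov, A. Pandey,
  F.-O. Schreyer, *Variety membership testing, algebraic natural proofs, and geometric complexity
  theory*, arXiv:1911.02534, §8.2, Thm. 36 and its proof (p0034:L1–L36).
* [Vardy97] A. Vardy, *The intractability of computing the minimum distance of a code*, IEEE Trans.
  Inform. Theory 43 (1997) — cited at p0034:L27 for the Vandermonde minors (not held; cited through
  BILPS).
-/

noncomputable section

namespace Literature.Barriers.ValiantsHypothesis

namespace BILPS19Thm36

open Polynomial Finset

variable {F : Type*} [Field F]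

/-! ### The polynomial of a coefficient vector -/

/-- Coefficients of `p_y = Σ_{a ≤ m} y_a X^a`. [cite: BlaserIkenmeyerLysikovPandeySchreyer2019, Thm. 36 (proof)] -/
theorem coeff_sum_C_mul_X_pow {m : ℕ} (y : Fin (m + 1) → F) (j : Fin (m + 1)) :
    (∑ a : Fin (m + 1), C (y a) * X ^ (a : ℕ)).coeff j = y j := by
  rw [finsetSum_coeff]
  simp_rw [coeff_C_mul, coeff_X_pow]
  rw [Finset.sum_eq_single j]
  · simp
  · intro a _ ha
    rw [if_neg (fun h => ha (Fin.ext h.symm)), mul_zero]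
  · simp

/-- Coefficients of `p_y` beyond `m` vanish. [cite: BlaserIkenmeyerLysikovPandeySchreyer2019, Thm. 36 (proof)] -/
theorem coeff_sum_C_mul_X_pow_of_lt {m : ℕ} (y : Fin (m + 1) → F) {j : ℕ} (hj : m < j) :
    (∑ a : Fin (m + 1), C (y a) * X ^ (a : ℕ)).coeff j = 0 := by
  rw [finsetSum_coeff]
  refine Finset.sum_eq_zero fun a _ => ?_
  rw [coeff_C_mul, coeff_X_pow, if_neg (by have := a.2; omega), mul_zero]

/-- `deg p_y ≤ m`. [cite: BlaserIkenmeyerLysikovPandeySchreyer2019, Thm. 36 (proof)] -/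
theorem natDegree_sum_C_mul_X_pow_le {m : ℕ} (y : Fin (m + 1) → F) :
    (∑ a : Fin (m + 1), C (y a) * X ^ (a : ℕ)).natDegree ≤ m :=
  natDegree_sum_le_of_forall_le _ _ fun a _ => (natDegree_C_mul_X_pow_le _ _).trans (Nat.lt_succ_iff.1 a.2)

/-- `p_y ≠ 0` for `y ≠ 0`. [cite: BlaserIkenmeyerLysikovPandeySchreyer2019, Thm. 36 (proof)] -/
theorem sum_C_mul_X_pow_ne_zero {m : ℕ} {y : Fin (m + 1) → F} (hy : y ≠ 0) :
    (∑ a : Fin (m + 1), C (y a) * X ^ (a : ℕ)) ≠ 0 := by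
  obtain ⟨a, ha⟩ := Function.ne_iff.1 hy
  intro h
  have := coeff_sum_C_mul_X_pow y a
  rw [h, coeff_zero] at this
  exact ha this.symm

/-- `p_y(z) = Σ_a y_a z^a`. [cite: BlaserIkenmeyerLysikovPandeySchreyer2019, Thm. 36 (proof)] -/
theorem eval_sum_C_mul_X_pow {m : ℕ} (y : Fin (m + 1) → F) (z : F) :
    (∑ a : Fin (m + 1), C (y a) * X ^ (a : ℕ)).eval z = ∑ a : Fin (m + 1), y a * z ^ (a : ℕ) := by
  simp [eval_finsetSum]

/-- A polynomial of degree `≤ m` is `p_y` for its coefficient vector `y`.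
[cite: BlaserIkenmeyerLysikovPandeySchreyer2019, Thm. 36 (proof)] -/
theorem sum_C_mul_X_pow_coeff_eq {m : ℕ} {p : F[X]} (hp : p.natDegree ≤ m) :
    (∑ a : Fin (m + 1), C (p.coeff a) * X ^ (a : ℕ)) = p := by
  conv_rhs => rw [p.as_sum_range_C_mul_X_pow' (Nat.lt_succ_of_le hp)]
  exact (Fin.sum_univ_eq_sum_range (fun i => C (p.coeff i) * X ^ i) (m + 1))

/-! ### The twist `τ(y) = −c y_m − y_{m−1}` -/

/-- **The twist**: `Σ_a y_a g_a = −(c y_m) − y_{m−1}` for `g_m = −c`, `g_{m−1} = −1`, `g_a = 0`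
otherwise (with `y_{−1} := 0`). [cite: BlaserIkenmeyerLysikovPandeySchreyer2019, Thm. 36 (proof)] -/
theorem twist_eq {m : ℕ} (y : Fin (m + 1) → F) (c : F) :
    (∑ a : Fin (m + 1), y a * (if (a : ℕ) = m then -c else if (a : ℕ) + 1 = m then -1 else 0)) =
      -(c * y (Fin.last m)) - (if h : 0 < m then y ⟨m - 1, by omega⟩ else 0) := by
  cases m with
  | zero => simp [mul_comm]
  | succ m =>
    rw [Fin.sum_univ_castSucc]
    simp only [Fin.val_castSucc, Fin.val_last, if_true, Nat.succ_pos, dif_pos,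
      Nat.add_sub_cancel]
    have h1 : ∀ a : Fin (m + 1), ((a : ℕ) = m + 1) = False := fun a => by
      have := a.2; simp only [eq_iff_iff, iff_false]; omega
    simp_rw [h1, if_false]
    rw [Finset.sum_eq_single (Fin.last m)]
    · simp only [Fin.val_last, if_true]
      have : (⟨m, by omega⟩ : Fin (m + 2)) = (Fin.last m).castSucc := Fin.ext (by simp)
      rw [this]
      ring
    · intro a _ ha
      rw [if_neg (fun h => ha (Fin.ext (by simp at h ⊢; omega))), mul_zero]
    · simp

/-! ### (⇒) few nonzero coordinates force a subset with the prescribed sum -/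

variable [DecidableEq F]

/-- **(⇒) Low weight forces a prescribed-sum `m`-subset of the points.** For pairwise distinct
points `x : ι → F`, `|ι| = 2m + 2`, a coefficient vector `y ≠ 0` whose word
`(p_y(x_i))_i, τ(y)` has at most `m + 2` nonzero coordinates yields an `m`-set `R` of indices with
`Σ_{i ∈ R} x_i = c` (and `R` is exactly the set of indices where `p_y` vanishes).
[cite: BlaserIkenmeyerLysikovPandeySchreyer2019, Thm. 36 (proof)] -/
theorem exists_subset_of_weight_le {ι : Type*} [Fintype ι] [DecidableEq ι] {m : ℕ}
    (x : ι → F) (hx : Function.Injective x) (hcard : Fintype.card ι = 2 * m + 2) (c : F)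
    (y : Fin (m + 1) → F) (hy : y ≠ 0)
    (hw : (univ.filter fun i => (∑ a : Fin (m + 1), C (y a) * X ^ (a : ℕ)).eval (x i) ≠ 0).card +
      (if (∑ a : Fin (m + 1), y a * (if (a : ℕ) = m then -c else if (a : ℕ) + 1 = m then -1 else 0)) = 0
        then 0 else 1) ≤ m + 2) :
    ∃ R : Finset ι, R.card = m ∧ (∀ i, i ∈ R ↔ (∑ a : Fin (m + 1), C (y a) * X ^ (a : ℕ)).eval (x i) = 0) ∧
      ∑ i ∈ R, x i = c := by
  classical
  set p := ∑ a : Fin (m + 1), C (y a) * X ^ (a : ℕ) with hp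
  have hp0 : p ≠ 0 := sum_C_mul_X_pow_ne_zero hy
  have hdeg : p.natDegree ≤ m := natDegree_sum_C_mul_X_pow_le y
  set Z := univ.filter (fun i => p.eval (x i) = 0) with hZ
  -- the vanishing points are roots: at most `m` of them
  have hZroots : (Z.image x).val ⊆ p.roots := by
    intro z hz
    rw [Finset.mem_val, Finset.mem_image] at hz
    obtain ⟨i, hi, rfl⟩ := hz
    rw [mem_roots hp0, IsRoot.def]
    exact (mem_filter.1 hi).2
  have hZx : (Z.image x).card = Z.card := card_image_of_injective _ hx
  have hZle : Z.card ≤ m := by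
    have h := card_le_degree_of_subset_roots hZroots
    rw [hZx] at h
    exact h.trans hdeg
  -- counting the nonzero coordinates
  have hsplit : Z.card + (univ.filter fun i => p.eval (x i) ≠ 0).card = 2 * m + 2 := by
    have h := Finset.card_filter_add_card_filter_not (s := (univ : Finset ι)) (fun i => p.eval (x i) = 0)
    rw [Finset.card_univ, hcard] at h
    simpa using h
  have key : Z.card = m ∧
      (∑ a : Fin (m + 1), y a * (if (a : ℕ) = m then -c else if (a : ℕ) + 1 = m then -1 else 0)) = 0 := by
    by_cases h : (∑ a : Fin (m + 1), y a * (if (a : ℕ) = m then -c else if (a : ℕ) + 1 = m then -1 else 0)) = 0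
    · rw [if_pos h] at hw
      exact ⟨by omega, h⟩
    · rw [if_neg h] at hw
      exfalso
      omega
  -- the roots of `p` are exactly the vanishing points, and `deg p = m`
  have hle : (Z.image x).val ≤ p.roots := Finset.val_le_iff_val_subset.2 hZroots
  have hZxm : (Z.image x).card = m := by rw [hZx, key.1]
  have hroots : (Z.image x).val = p.roots :=
    Multiset.eq_of_le_of_card_le hle (by rw [Finset.card_val, hZxm]; exact (card_roots' p).trans hdeg)
  have hnat : p.natDegree = m := by
    refine le_antisymm hdeg ?_
    have h := card_roots' p
    rwa [← hroots, Finset.card_val, hZxm] at h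
  have hlead : p.leadingCoeff = y (Fin.last m) := by
    rw [leadingCoeff, hnat]
    exact coeff_sum_C_mul_X_pow y (Fin.last m)
  have hlead0 : y (Fin.last m) ≠ 0 := by
    rw [← hlead]
    exact leadingCoeff_ne_zero.2 hp0
  have hfac : C p.leadingCoeff * ∏ i ∈ Z, (X - C (x i)) = p := by
    have h := C_leadingCoeff_mul_prod_multiset_X_sub_C (p := p)
      (by rw [← hroots, Finset.card_val, hZxm, hnat])
    rw [← hroots] at h
    have hprod : ((Z.image x).val.map fun a => X - C a).prod = ∏ i ∈ Z, (X - C (x i)) := by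
      rw [← Finset.prod_image (s := Z) (g := x) (f := fun a => X - C a) fun a _ b _ hab => hx hab]
      rfl
    rwa [hprod] at h
  refine ⟨Z, key.1, fun i => by simp [hZ], ?_⟩
  -- the twist vanishes: `Σ_Z x = c`
  have htw := key.2
  rw [twist_eq] at htw
  rcases Nat.eq_zero_or_pos m with hm0 | hmpos
  · subst hm0
    rw [dif_neg (lt_irrefl 0), sub_zero, neg_eq_zero] at htw
    have hc : c = 0 := (mul_eq_zero.1 htw).resolve_right hlead0
    rw [Finset.card_eq_zero.1 key.1, Finset.sum_empty, hc]
  · rw [dif_pos hmpos] at htw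
    have hcoef : y ⟨m - 1, by omega⟩ = p.coeff (m - 1) := (coeff_sum_C_mul_X_pow y ⟨m - 1, by omega⟩).symm
    have h2 := prod_X_sub_C_coeff_card_pred Z x (by rw [key.1]; exact hmpos)
    rw [key.1] at h2
    have hvieta : p.coeff (m - 1) = p.leadingCoeff * -(∑ i ∈ Z, x i) := by
      conv_lhs => rw [← hfac]
      rw [coeff_C_mul, h2]
    rw [hcoef, hvieta, hlead] at htw
    have h3 : y (Fin.last m) * (∑ i ∈ Z, x i - c) = 0 := by linear_combination htw
    exact sub_eq_zero.1 ((mul_eq_zero.1 h3).resolve_left hlead0)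

/-! ### (⇐) a subset with the prescribed sum gives a word of weight `m + 2` -/

/-- **(⇐) A prescribed-sum `m`-subset gives a low-weight word.** For an `m`-set `R` of indices with
`Σ_{i∈R} x_i = c`, the coefficient vector `y` of `Π_{i∈R} (X − x_i)` is nonzero, `p_y` vanishes
exactly on `R` (so the evaluation part has `|ι| − m` nonzero coordinates), and the twist vanishes.
[cite: BlaserIkenmeyerLysikovPandeySchreyer2019, Thm. 36 (proof)] -/
theorem weight_of_subset {ι : Type*} [Fintype ι] [DecidableEq ι] {m : ℕ}
    (x : ι → F) (hx : Function.Injective x) (c : F) (R : Finset ι) (hR : R.card = m)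
    (hsum : ∑ i ∈ R, x i = c) :
    ∃ y : Fin (m + 1) → F, y ≠ 0 ∧
      (∀ i, (∑ a : Fin (m + 1), C (y a) * X ^ (a : ℕ)).eval (x i) = 0 ↔ i ∈ R) ∧
      (univ.filter fun i => (∑ a : Fin (m + 1), C (y a) * X ^ (a : ℕ)).eval (x i) ≠ 0).card =
        Fintype.card ι - m ∧
      (∑ a : Fin (m + 1), y a * (if (a : ℕ) = m then -c else if (a : ℕ) + 1 = m then -1 else 0)) = 0 := by
  classical
  set q := ∏ i ∈ R, (X - C (x i)) with hq
  have hmonic : q.Monic := monic_prod_of_monic _ _ fun i _ => monic_X_sub_C (x i)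
  have hnat : q.natDegree = m := by rw [hq, natDegree_finsetProd_X_sub_C_eq_card, hR]
  have hm : q.coeff m = 1 := by rw [← hnat, hmonic.coeff_natDegree]
  have hpoly : (∑ a : Fin (m + 1), C ((fun a : Fin (m + 1) => q.coeff a) a) * X ^ (a : ℕ)) = q :=
    sum_C_mul_X_pow_coeff_eq hnat.le
  have hev : ∀ i, q.eval (x i) = 0 ↔ i ∈ R := fun i => by
    rw [hq, eval_prod, Finset.prod_eq_zero_iff]
    simp only [eval_sub, eval_X, eval_C, sub_eq_zero]
    exact ⟨fun ⟨j, hj, h⟩ => hx h ▸ hj, fun h => ⟨i, h, rfl⟩⟩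
  refine ⟨fun a => q.coeff a, ?_, ?_, ?_, ?_⟩
  · refine Function.ne_iff.2 ⟨Fin.last m, ?_⟩
    rw [Pi.zero_apply, Fin.val_last, hm]
    exact one_ne_zero
  · intro i
    rw [hpoly]
    exact hev i
  · rw [hpoly]
    have hset : (univ.filter fun i => q.eval (x i) ≠ 0) = univ \ R := by
      ext i
      simp [hev]
    rw [hset, Finset.card_univ_sdiff, hR]
  · rw [twist_eq]
    rcases Nat.eq_zero_or_pos m with hm0 | hmpos
    · subst hm0
      have hR0 : R = ∅ := Finset.card_eq_zero.1 hR
      rw [hR0, Finset.sum_empty] at hsum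
      simp [← hsum]
    · rw [dif_pos hmpos]
      have h2 := prod_X_sub_C_coeff_card_pred R x (by rw [hR]; exact hmpos)
      rw [hR, ← hq] at h2
      simp only [Fin.val_last]
      rw [hm, h2, hsum]
      ring

/-! ### Rank of a diagonal pencil -/

/-- **"The rank of a linear combination of `B_i` is equal to the number of nonzero coordinates in the
corresponding linear combination of vectors `b_i`"** (p0034:L33): the rank of a diagonal matrix is
the number of its nonzero diagonal entries. [cite: BlaserIkenmeyerLysikovPandeySchreyer2019, Thm. 36 (proof)] -/
theorem rank_diagonal_eq_card_filter {n : Type*} [Fintype n] [DecidableEq n] (w : n → F) :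
    (Matrix.diagonal w).rank = (univ.filter fun i => w i ≠ 0).card := by
  rw [Matrix.rank_diagonal, Fintype.card_subtype]

end BILPS19Thm36

end Literature.Barriers.ValiantsHypothesis
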